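import Summits.ABC.IUTFork.Cor312PinnedRegions
import Summits.ABC.IUTFork.Thm311ToCor312
import Summits.ABC.IUTFork.Cor312LogKummerRoute
import HarnessLib

/-!
# [IUTchIII] Cor. 3.12 — the THIRD PIN (pL): the Θ×μ_LGP-link's pilot law, and the gaps GapA3 / GapH3 under three pins

Record file (D-0012; abc-iut cell, wave 5, seat abc-iut-w5-d230 = PR-1 part S1; companion of `Cor312PinnedRegions`
(p417551), written for director-abc's PR ADDENDUM 2026-08-26T02:18:52Z after lane A2 row R13 «LinkGluing WEAKER-THAN-PRINT —
pilot law printed», adopted as plan/ADJUDICATION-SPEC.md v2.3 (G-PINNED-2) (a)). TAKES NO SIDE on [IUTchIII] Cor. 3.12. NO `Prop`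
FACT: `LinkPinned`, `PinnedRegions3`, `GapA3`, `GapH3`, `PilotKummerIndRelated` are READING PREDICATES parametrised by the setting and the
region reading `ρ` / q-datum `qK` (as `Cor312Vol.BridgeHyps`, `Cor312Vol.PinnedRegions`); nothing is asserted. S. Mochizuki,
*Inter-universal Teichmüller theory III*, kurims manuscript (May 2020) = `paper:url-4b091feeb646` (render
HOME/lit/renders/IUTchIII-kurims-url-4b091feeb646, this cell). [claim: Mochizuki2012, status: disputed]

THE THIRD PRINTED PIN (pL) — the link's PILOT LAW. Def. 3.8 (ii), p. 112 l. 64 – p. 113 l. 43: "we shall refer to the full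
poly-isomorphism of F⊩▶×μ-prime-strips †𝔉⊩▶×μ_LGP ⥲ ∗𝔉⊩▶×μ_△ as the Θ×μ_LGP-link"; Rmk. 3.8.1, p. 114 l. 68–70: "we note,
for future reference, that both the Θ×μ_LGP- and the Θ×μ_lgp-link map Θ-pilot objects to q-pilot objects"; Cor. 3.12, proof,
Step (i), p. 175 l. 48–49: "[the Θ×μ_]LGP-link maps Θ-pilot objects of ^{0,0}𝓗𝓣^{Θ±ell NF} to q-pilot objects of
^{1,0}𝓗𝓣^{Θ±ell NF} [cf. Remark 3.8.1]"; Step (xi-a), p. 181 l. 37–44: "the Θ×μ_LGP-link from (0,0) to (1,0) may be interpreted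
as a sort of gluing isomorphism […] in such a way that the Θ-pilot object at (0,0) […] corresponds to the q-pilot object at
(1,0)"; the Kummer isomorphisms the link is compatible with: Thm. 3.11 (ii), p. 155 l. 10 ff., and (iii) (a), (b), p. 156 l. 44 –
p. 157 l. 30 ("Relative to this Kummer isomorphism, the full poly-isomorphism of F⊢×μ-prime-strips 𝔉⊢×μ_△(^{n,∘}𝔇⊢_△) ⥲
𝔉⊢×μ_△(^{n+1,∘}𝔇⊢_△) is compatible with the full poly-isomorphism […] induced […] by the horizontal arrows").

EXPRESSIBILITY (the sentence for the RESULT line, verbatim): «frozen `Thm311.LinkData` carries the Θ×μ_LGP-link only as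
`horizontal := PolyIso.full` between ABSTRACT 𝓕⊢×μ-prime-strips (no objects, regions or Kummer data — `LinkData.partIIIa_holds` /
`partIIIb_holds` are theorems for every `LinkData`) and `Thm311.Column` carries no q-pilot Kummer datum, so the pilot law is
expressible only at the level of the setting's pilot OBJECTS (abc-iut-c312-1's `Thm311ToCor312.PilotLink`: an identification
`Ob 𝒞⊩_lgp ≃ Ob 𝒞⊩_△` carrying the Θ-pilot to the q-pilot; equivalently a `Cor312Vol.LinkGluing` whose sole law is
`link_thetaPilot`), NOT as a relation between the q-pilot's Kummer datum `qK` and the Θ-pilot's Kummer images `Column.frobΨ m`;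
that relation is the residual `PilotKummerIndRelated` below (= `GapA3` under the three pins, (xi-e)/(xi-f) p. 183 l. 43 – p. 184
l. 29).» ONE region reading `ρ` for both sides (its ⟨(Ind1) ∪ (Ind2)⟩-equivariance (hρ) inside `ThetaPinned` IS abc-iut-w5-d220's
(b1)-equivariance at the pilot).

SIBLING FILES OF THE ROUND (not restated here): abc-iut-w5-d155's `Cor312PinnedRegionsLink` (p418443) types the finer PACKET-LEVEL
reading of «the Kummer image of the q-pilot THROUGH the link» as inline hypotheses (L) `qK = Φ₀ · Ψ^{Frob}_{(n−1,m₀)}` and (LI)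
`Φ₀ ∈ ⟨(Ind1) ∪ (Ind2)⟩`, with the exact decomposition `PinnedLink.qGlue_iff_exists_link` ((b2) = (L′) ∧ (LI)) — a datum-level
transport `qK = Φ₀ · Ψ_n` with `Φ₀ ∈ ⟨(Ind1) ∪ (Ind2)⟩` implies the region-level residual `PilotKummerIndRelated` below —, and
`PinnedLink.link_alternative` (Step (x) decides (LI) by volumes); abc-iut-w4-d103's `Cor312PinnedRegionsHonest` (p418630) proves
`¬ GapA''` on EVERY honestly-scaled pin-respecting setting; abc-iut-w4-d101's `Cor312PinnedSetting` (p418585) is PR-2's object-honest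
pinned model (its `pinLinkGluing`/`pinSetting_pilotLink` is a CONTENTFUL instance of (pL); on one-point `toySig` objects (pL) is
vacuous — abc-iut-w4-d006's PR3-F2/C14).

CONTENTS. §1 the pin (pL) and `PinnedRegions3 := PinnedRegions ∧ LinkPinned` ((pΘ) ∧ (pq′) ∧ (pL)); `GapA3` := R3 under the three
pins; `GapH3` := abc-iut-c312-1's hull-level `Licence` under the three pins (PR-3 finding F1: `GapA3` is an
IDENTIFICATION-level reading, stronger than (xi-f)'s «inclusion … follows formally»; `GapA3 → GapH3 → Statement`). §2 the HONEST RESIDUAL `PilotKummerIndRelated` («the link-matched pilots have (Ind1),(Ind2)-related Kummer images in the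
étale container, read through ρ»; (Ind3), the column index `m`, is absorbed by Thm. 3.11 (ii) (b) `frobΨ m = Ψ`) and
`gapA3_iff : GapA3 ↔ (PinnedRegions3 → PilotKummerIndRelated)` under (ii) (b). §3 the Statement from the three pins + the residual
(the (P″)-shaped derivation MODULO the residual), link-less models decide nothing (`gapA3_of_not_linkPinned`), both frozen link
vocabularies agree (`linkGluing_of_linkPinned`, `linkPinned_of_linkGluing_of_bijective`). §4 the same over the typed Theorem 3.11
(`FullSituation.Statement`). Nothing asserted; typed ≠ proved.
-/

noncomputable section

open Set

namespace Summit.ABC.IUTFork.Cor312Vol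

open Thm311 Cor312 Literature.IUT.LogThetaLattice

variable {T : ThetaIndex} (S : LatticeSituation T) (P : Cor312.Setting S.toSituation)
  (ρ : (∀ v : T.V, v ∈ T.Vbad → Set (S.L.StarPacket v)) → ∀ (j : T.Label) (vQ : T.VQ), Set (S.L.Packet j vQ))
  (qK : ∀ v : T.V, v ∈ T.Vbad → Set (S.L.StarPacket v))

/-! ## 1. The third pin and the three-pin predicates -/

/-- **(pL): the LINK PIN — the Θ×μ_LGP-link's pilot law** (Def. 3.8 (ii) p. 112 l. 64 – p. 113 l. 43; Rmk. 3.8.1 p. 114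
l. 68–70 "both the Θ×μ_LGP- and the Θ×μ_lgp-link map Θ-pilot objects to q-pilot objects"; Cor. 3.12 Step (i) p. 175 l. 48–49;
Step (xi-a) p. 181 l. 37–44; all quoted in the module docstring), TYPED AT THE OBJECT LEVEL by abc-iut-c312-1's
`Thm311ToCor312.PilotLink`: an identification of the objects of the setting's global realified Frobenioids `𝒞⊩_lgp ≃ 𝒞⊩_△`
carrying the Θ-pilot object to the q-pilot object (what the FULL poly-isomorphism of 𝓕⊩▶×μ-prime-strips supplies on objects).
This is the only level at which the frozen vocabulary can carry the pilot law (expressibility sentence of the module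
docstring). READING PREDICATE, never asserted. [claim: Mochizuki2012, status: disputed] -/
@[claim "Mochizuki2012" "disputed"]
def LinkPinned : Prop := Thm311ToCor312.PilotLink P

/-- **`PinnedRegions3` — THE THREE PINS (pΘ) ∧ (pq′) ∧ (pL)** of director-abc 2026-08-26T02:18:52Z / ADJUDICATION-SPEC v2.3
(G-PINNED-2) (a): abc-iut-w5-d230's two-pin `PinnedRegions` (Cor. 3.12 statement p. 173 l. 46 – p. 174 l. 9, with ONE region
reading `ρ` for both pilots and its (hρ)-equivariance) AND the link pin. READING PREDICATE, never asserted.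
[claim: Mochizuki2012, status: disputed] -/
@[claim "Mochizuki2012" "disputed"]
def PinnedRegions3 : Prop := PinnedRegions S P ρ qK ∧ LinkPinned S P

/-- **`GapA3` — the gap under ALL THREE pins**: the three pins imply READING R3 (the Kummer-image region of the q-pilot is a
possible image of the Θ-pilot at every `(j, v_ℚ)`) — print's argued, hedged inference at (xi-e)/(xi-f), p. 183 l. 43 – p. 184
l. 29. READING PREDICATE (an implication between readings), never asserted. [claim: Mochizuki2012, status: disputed] -/
@[claim "Mochizuki2012" "disputed"]
def GapA3 : Prop := PinnedRegions3 S P ρ qK → ∀ (j : T.Label) (vQ : T.VQ), P.qRegion j vQ ∈ P.possibleImages j vQ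

/-- Bookkeeping: the three pins, unfolded one level. [folklore] -/
theorem pinnedRegions3_iff :
    PinnedRegions3 S P ρ qK ↔ ThetaPinned S P ρ ∧ QPinned S P ρ qK ∧ Thm311ToCor312.PilotLink P :=
  and_assoc

/-- More pins, weaker gap: the two-pin `GapA''` implies `GapA3`. [folklore] -/
theorem gapA3_of_gapA'' (h : GapA'' S P ρ qK) : GapA3 S P ρ qK := fun hpin => h hpin.1

/-- A model WITHOUT the link decides nothing: if (pL) fails, `GapA3` holds vacuously — PR-2's countermodels must carry the
link (ADJUDICATION-SPEC v2.3 (G-PINNED-2) (a): "a model that omits the link is graded interface-level"). [folklore] -/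
theorem gapA3_of_not_linkPinned (h : ¬ LinkPinned S P) : GapA3 S P ρ qK := fun hpin => absurd hpin.2 h

/-- … and if any pin fails, `GapA3` holds vacuously. [folklore] -/
theorem gapA3_of_not_pinned3 (h : ¬ PinnedRegions3 S P ρ qK) : GapA3 S P ρ qK := fun hpin => absurd hpin h

/-- If READING R3 holds outright, `GapA3` holds for every choice of `ρ`, `qK`. [folklore] -/
theorem gapA3_of_reading3 (h : ∀ (j : T.Label) (vQ : T.VQ), P.qRegion j vQ ∈ P.possibleImages j vQ) : GapA3 S P ρ qK :=
  fun _ => h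

/-- **`GapH3` — the HULL-LEVEL gap under the three pins** (PR-3 finding F1, abc-iut-w4-d103 2026-08-26T02:41:25Z: `GapA''`/`GapA3`
read (xi-e)/(xi-f) as an IDENTIFICATION of Kummer images — per packet, set-level, PRE-hull and PRE-union —, which is STRONGER than
(xi-f) p. 184 l. 26–27 «the inclusion −|log(q)| ∈ ℝ_{≤−|log(Θ)|} […] then follows formally» read on regions; the hull-level pinned
residual is abc-iut-c312-1's `Thm311ToCor312.Licence` — «at every label of 𝔽_l^⋇ the q-pilot's region lies in the holomorphic hull
ⁿ˒°𝒰 of the union of the possible images» — under the pins): THREE PINS ⟹ `Licence`. READING PREDICATE (an implication between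
readings), never asserted; `GapA3 → GapH3` (`gapH3_of_gapA3`), and `GapH3` already gives the Statement (`statement_of_gapH3`).
[claim: Mochizuki2012, status: disputed] -/
@[claim "Mochizuki2012" "disputed"]
def GapH3 : Prop := PinnedRegions3 S P ρ qK → Thm311ToCor312.Licence P

/-- The identification-level gap implies the hull-level gap (READING R3 ⟹ the licence, abc-iut-c312-1). [folklore] -/
theorem gapH3_of_gapA3 (h : GapA3 S P ρ qK) : GapH3 S P ρ qK :=
  fun hpin => Thm311ToCor312.licence_of_qRegion_mem_possibleImages P fun i vQ => h hpin (Setting.labelSucc i) vQ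

/-- `GapH3` unfolded under the q-pin: THREE PINS ⟹ `ρ(qK) ⊆ ⁿ˒°𝒰_{j,v_ℚ}` at every label of `𝔽_l^⋇`. [folklore] -/
theorem gapH3_iff :
    GapH3 S P ρ qK ↔ (PinnedRegions3 S P ρ qK →
      ∀ (i : Fin T.lstar) (vQ : T.VQ), ρ qK (Setting.labelSucc i) vQ ⊆ P.thetaHull (Setting.labelSucc i) vQ) :=
  ⟨fun h hpin i vQ => by rw [← hpin.1.2 _ vQ]; exact h hpin i vQ,
    fun h hpin i vQ => by rw [hpin.1.2 _ vQ]; exact h hpin i vQ⟩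

/-- If any pin fails, `GapH3` holds vacuously (as for `GapA3`). [folklore] -/
theorem gapH3_of_not_pinned3 (h : ¬ PinnedRegions3 S P ρ qK) : GapH3 S P ρ qK := fun hpin => absurd hpin h

/-! ## 2. The honest residual under the three pins -/

/-- **`PilotKummerIndRelated` — THE HONEST RESIDUAL** (director-abc 02:18:52Z: «link-isomorphic pilots have (Ind1,2,3)-related
Kummer images in the étale container at n+1» = (xi-e)/(xi-f), p. 183 l. 43 – p. 184 l. 29), in the region reading `ρ`: at every
`(j, v_ℚ)` the q-pilot's Kummer datum `qK` generates the same `ρ`-region as the splitting monoid of SOME (Ind1),(Ind2)-translate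
`D′ ∈ ^{n,∘}ℜ^LGP` of the line-`n` Θ-data (abc-iut-w5-d220's (b2) up to one indeterminacy; the (Ind3)-index `m` is absorbed by
Thm. 3.11 (ii) (b): `frobΨ m = Ψ` for every `m`). No clause of the typed Theorem 3.11 states it (expressibility sentence).
READING PREDICATE, never asserted. [claim: Mochizuki2012, status: disputed] -/
@[claim "Mochizuki2012" "disputed"]
def PilotKummerIndRelated : Prop :=
  ∀ (j : T.Label) (vQ : T.VQ), ∃ D' ∈ S.RLGP P.n, ρ qK j vQ = ρ D'.Ψ j vQ

/-- Under the pins (two suffice) and Thm. 3.11 (ii) (b) for column `n`, READING R3 ⟺ the residual. [claim: Mochizuki2012, status: disputed] -/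
theorem reading3_iff_pilotKummerIndRelated (hKumB : (S.col P.n).KummerB (S.D P.n)) (hpin : PinnedRegions S P ρ qK) :
    (∀ (j : T.Label) (vQ : T.VQ), P.qRegion j vQ ∈ P.possibleImages j vQ) ↔ PilotKummerIndRelated S P ρ qK :=
  gapA''_iff_qGlue S P ρ qK hKumB hpin

/-- **`gapA3_iff`**: under Thm. 3.11 (ii) (b) for column `n`, `GapA3` ⟺ (THREE PINS ⟹ `PilotKummerIndRelated`). So, granted the
Corollary's own two region pins and the link's pilot law, what print argues at (xi-e)/(xi-f) is EXACTLY the residual.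
[claim: Mochizuki2012, status: disputed] -/
theorem gapA3_iff (hKumB : (S.col P.n).KummerB (S.D P.n)) :
    GapA3 S P ρ qK ↔ (PinnedRegions3 S P ρ qK → PilotKummerIndRelated S P ρ qK) :=
  ⟨fun h hpin => (reading3_iff_pilotKummerIndRelated S P ρ qK hKumB hpin.1).1 (h hpin),
    fun h hpin => (reading3_iff_pilotKummerIndRelated S P ρ qK hKumB hpin.1).2 (h hpin)⟩

/-- `GapA3` and the two-pin `GapA''` say the same thing ON LINK-PINNED settings. [folklore] -/
theorem gapA3_iff_gapA''_of_linkPinned (hL : LinkPinned S P) : GapA3 S P ρ qK ↔ GapA'' S P ρ qK :=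
  ⟨fun h hpin => h ⟨hpin, hL⟩, fun h hpin => h hpin.1⟩

/-- The LINK-FAITHFUL sufficient condition for the residual (abc-iut-w5-d230's (b2′), the object-level seed (xi-a) read at
region level): if `qK` generates the same `ρ`-region as the Frobenius-like Θ-splitting monoid of the PREVIOUS column at some
`(n−1, m₀)`, then under Thm. 3.11 (i) `MultiradialCompat` and (ii) (b) for column `n−1` the residual holds.
[claim: Mochizuki2012, status: disputed] -/
theorem pilotKummerIndRelated_of_linkedGlue (hMR : S.MultiradialCompat)
    (hKumB' : (S.col (P.n - 1)).KummerB (S.D (P.n - 1))) (m₀ : ℤ)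
    (hlink : ∀ (j : T.Label) (vQ : T.VQ), ρ qK j vQ = ρ ((S.col (P.n - 1)).frobΨ m₀) j vQ) :
    PilotKummerIndRelated S P ρ qK := fun j vQ => by
  refine ⟨S.D (P.n - 1), S.mem_RLGP_of_multiradialCompat hMR _ _, ?_⟩
  have hΨ : (S.col (P.n - 1)).frobΨ m₀ = (S.D (P.n - 1)).Ψ := funext fun v => funext fun hv => hKumB' m₀ v hv
  rw [hlink j vQ, hΨ]

/-! ## 3. The Statement under the three pins; the two frozen link vocabularies -/

/-- **`statement_of_gapA3`**: bridge hypotheses + three pins + `GapA3` ⟹ the printed Statement of Cor. 3.12 (`−|log(Θ)| ∈ ℝ`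
and `−|log(q)| ≤ −|log(Θ)|`), through abc-iut-c312-6's R3 bridge. [claim: Mochizuki2012, status: disputed] -/
theorem statement_of_gapA3 (H : BridgeHyps P) (hpin : PinnedRegions3 S P ρ qK) (hgap : GapA3 S P ρ qK) : P.Statement :=
  statement_of_qRegion_mem_possibleImages H fun i vQ => hgap hpin (Setting.labelSucc i) vQ

/-- **`statement_of_gapH3`**: bridge hypotheses + three pins + the HULL-LEVEL gap ⟹ the printed Statement (abc-iut-c312-1's
`statement_of_licence`: monotonicity of the log-volume under the hull). [claim: Mochizuki2012, status: disputed] -/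
theorem statement_of_gapH3 (H : BridgeHyps P) (hpin : PinnedRegions3 S P ρ qK) (hgap : GapH3 S P ρ qK) : P.Statement :=
  Thm311ToCor312.statement_of_licence H (hgap hpin)

/-- **The (P″)-shaped derivation MODULO THE RESIDUAL**: bridge hypotheses + Thm. 3.11 (ii) (b) for column `n` + three pins +
`PilotKummerIndRelated` ⟹ the printed Statement. (Without the residual no derivation is claimed.) [claim: Mochizuki2012, status: disputed] -/
theorem statement_of_pinned3_of_pilotKummerIndRelated (H : BridgeHyps P) (hKumB : (S.col P.n).KummerB (S.D P.n))
    (hpin : PinnedRegions3 S P ρ qK) (hres : PilotKummerIndRelated S P ρ qK) : P.Statement :=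
  statement_of_qRegion_mem_possibleImages H fun i vQ =>
    (reading3_iff_pilotKummerIndRelated S P ρ qK hKumB hpin.1).2 hres (Setting.labelSucc i) vQ

/-- The object-level pilot law in abc-iut-c312-1's vocabulary gives one in the `Cor312LogKummerRoute` vocabulary: a
`LinkGluing` (value-group-portion map on objects with `link_thetaPilot`). [folklore] -/
theorem linkGluing_of_linkPinned (hL : LinkPinned S P) : Nonempty (LinkGluing P) := by
  obtain ⟨e, he⟩ := hL
  exact ⟨⟨e, he⟩⟩

/-- Conversely a `LinkGluing` whose object map is a bijection (the link is a poly-ISOMORPHISM) is a pilot law in c312-1's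
sense. [folklore] -/
theorem linkPinned_of_linkGluing_of_bijective (G : LinkGluing P) (hG : Function.Bijective G.linkMap) : LinkPinned S P :=
  ⟨Equiv.ofBijective G.linkMap hG, G.link_thetaPilot⟩

/-- Any identification of the pilot objects carrying Θ-pilot to q-pilot pins the link. [folklore] -/
theorem linkPinned_of_equiv (e : P.Ob P.sig.Clgp ≃ P.ObΔ) (he : e P.thetaPilot = P.qPilot) : LinkPinned S P := ⟨e, he⟩

/-! ## 4. Over the typed Theorem 3.11 -/

/-- **PR-1 with three pins, assembled over the typed Theorem 3.11**: for a full situation satisfying `FullSituation.Statement`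
([IUTchIII] Thm. 3.11 (i) ∧ (ii) ∧ (iii) as frozen) and a Cor.-3.12 setting with abc-iut-c312-6's `BridgeHyps`: THREE PINS +
`GapA3` ⟹ the printed Statement. [claim: Mochizuki2012, status: disputed] -/
theorem statement_of_thm311_of_pinned3_of_gapA3 (S : FullSituation T) (P : Cor312.Setting S.toLatticeSituation.toSituation)
    (ρ : (∀ v : T.V, v ∈ T.Vbad → Set (S.L.StarPacket v)) → ∀ (j : T.Label) (vQ : T.VQ), Set (S.L.Packet j vQ))
    (qK : ∀ v : T.V, v ∈ T.Vbad → Set (S.L.StarPacket v))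
    (H : BridgeHyps P) (hpin : PinnedRegions3 S.toLatticeSituation P ρ qK) (hgap : GapA3 S.toLatticeSituation P ρ qK) :
    P.Statement :=
  statement_of_gapA3 S.toLatticeSituation P ρ qK H hpin hgap

/-- The same with the HULL-LEVEL gap: typed Theorem 3.11 + bridge hypotheses + THREE PINS + `GapH3` ⟹ the printed Statement.
[claim: Mochizuki2012, status: disputed] -/
theorem statement_of_thm311_of_pinned3_of_gapH3 (S : FullSituation T) (P : Cor312.Setting S.toLatticeSituation.toSituation)
    (ρ : (∀ v : T.V, v ∈ T.Vbad → Set (S.L.StarPacket v)) → ∀ (j : T.Label) (vQ : T.VQ), Set (S.L.Packet j vQ))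
    (qK : ∀ v : T.V, v ∈ T.Vbad → Set (S.L.StarPacket v))
    (H : BridgeHyps P) (hpin : PinnedRegions3 S.toLatticeSituation P ρ qK) (hgap : GapH3 S.toLatticeSituation P ρ qK) :
    P.Statement :=
  statement_of_gapH3 S.toLatticeSituation P ρ qK H hpin hgap

/-- **`GapA3` under the typed Theorem 3.11, unfolded** (for the GAP-LEDGER / RESULT line): GapA3 ⟺ (PinnedRegions3 ⟹
PilotKummerIndRelated). [claim: Mochizuki2012, status: disputed] -/
theorem gapA3_iff_of_thm311 (S : FullSituation T) (P : Cor312.Setting S.toLatticeSituation.toSituation)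
    (ρ : (∀ v : T.V, v ∈ T.Vbad → Set (S.L.StarPacket v)) → ∀ (j : T.Label) (vQ : T.VQ), Set (S.L.Packet j vQ))
    (qK : ∀ v : T.V, v ∈ T.Vbad → Set (S.L.StarPacket v)) (hThm : S.Statement) :
    GapA3 S.toLatticeSituation P ρ qK ↔
      (PinnedRegions3 S.toLatticeSituation P ρ qK → PilotKummerIndRelated S.toLatticeSituation P ρ qK) :=
  gapA3_iff S.toLatticeSituation P ρ qK (GluedMonoids.kummerB_of_statement S hThm P.n)

/-- The typed Theorem 3.11 + three pins + the residual ⟹ the printed Statement. [claim: Mochizuki2012, status: disputed] -/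
theorem statement_of_thm311_of_pinned3_of_pilotKummerIndRelated (S : FullSituation T)
    (P : Cor312.Setting S.toLatticeSituation.toSituation)
    (ρ : (∀ v : T.V, v ∈ T.Vbad → Set (S.L.StarPacket v)) → ∀ (j : T.Label) (vQ : T.VQ), Set (S.L.Packet j vQ))
    (qK : ∀ v : T.V, v ∈ T.Vbad → Set (S.L.StarPacket v)) (hThm : S.Statement) (H : BridgeHyps P)
    (hpin : PinnedRegions3 S.toLatticeSituation P ρ qK) (hres : PilotKummerIndRelated S.toLatticeSituation P ρ qK) :
    P.Statement :=
  statement_of_pinned3_of_pilotKummerIndRelated S.toLatticeSituation P ρ qK H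
    (GluedMonoids.kummerB_of_statement S hThm P.n) hpin hres

/-- The typed Theorem 3.11 + three pins + the LINK-FAITHFUL q-glue (b2′) ⟹ the printed Statement (the residual supplied by
`pilotKummerIndRelated_of_linkedGlue`). [claim: Mochizuki2012, status: disputed] -/
theorem statement_of_thm311_of_pinned3_of_linkedGlue (S : FullSituation T)
    (P : Cor312.Setting S.toLatticeSituation.toSituation)
    (ρ : (∀ v : T.V, v ∈ T.Vbad → Set (S.L.StarPacket v)) → ∀ (j : T.Label) (vQ : T.VQ), Set (S.L.Packet j vQ))
    (qK : ∀ v : T.V, v ∈ T.Vbad → Set (S.L.StarPacket v)) (hThm : S.Statement) (H : BridgeHyps P)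
    (hpin : PinnedRegions3 S.toLatticeSituation P ρ qK) (m₀ : ℤ)
    (hlink : ∀ (j : T.Label) (vQ : T.VQ), ρ qK j vQ = ρ ((S.col (P.n - 1)).frobΨ m₀) j vQ) : P.Statement :=
  statement_of_thm311_of_pinned3_of_pilotKummerIndRelated S P ρ qK hThm H hpin
    (pilotKummerIndRelated_of_linkedGlue S.toLatticeSituation P ρ qK (GluedMonoids.multiradialCompat_of_statement S hThm)
      (GluedMonoids.kummerB_of_statement S hThm (P.n - 1)) m₀ hlink)

end Summit.ABC.IUTFork.Cor312Vol

end
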